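import Summits.AtomisticToContinuum.Crystallization.Theorems.ChargedEnergyGapStabilityNumericsA
import HarnessLib

/-!
# «StabilityNumerics» P-L STAB-61 in the kernel (lens-3 g61) — part 2 of 4 (sequel of `…ChargedEnergyGapStabilityNumericsA`)

Split for the 400-line cap by the landing lane (hand-2 g31); the module docstring of part 1 (`…ChargedEnergyGapStabilityNumericsA`) describes the whole node.  Same namespace; all FQNs unchanged.
0 sorry; standard axioms.
-/

noncomputable section
open scoped Classical
open Literature.MathematicalPhysics.StatisticalMechanics
open Literature.Geometry.DiscreteGeometry
open Summit.AtomisticToContinuum.Crystallization.Theses.PricedLinkCensus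
open Summit.AtomisticToContinuum.Crystallization.Theorems.ChargedEnergyGapNegative

namespace Summit.AtomisticToContinuum.Crystallization.Theorems.ChargedEnergyGapChartDial

namespace Fcc

section Numerics

variable {b : ℝ}

/-! ### L3. Cubes, layers and the tail estimate `Σ_{|n|_∞ > K} c|n|⁻⁶ ≤ 26c/(3K³)` -/

/-- The cube `[−M, M]³ ⊂ ℤ³`. -/
def cube (M : ℕ) : Finset (Fin 3 → ℤ) := Fintype.piFinset fun _ => Finset.Icc (-(M : ℤ)) M

/-- The sup-norm `|x|_∞`. -/
def cmax (x : Fin 3 → ℤ) : ℕ := Finset.univ.sup fun k => (x k).natAbs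

/-- `natAbs_le_cmax` (docstring added by the landing lane; see the module docstring). [formal bookkeeping] -/
theorem natAbs_le_cmax (x : Fin 3 → ℤ) (k : Fin 3) : (x k).natAbs ≤ cmax x :=
  Finset.le_sup (f := fun k => (x k).natAbs) (Finset.mem_univ k)

/-- `exists_eq_cmax` (docstring added by the landing lane; see the module docstring). [formal bookkeeping] -/
theorem exists_eq_cmax (x : Fin 3 → ℤ) : ∃ k, cmax x = (x k).natAbs := by
  obtain ⟨k, -, hk⟩ := Finset.exists_mem_eq_sup (Finset.univ : Finset (Fin 3)) Finset.univ_nonempty fun k => (x k).natAbs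
  exact ⟨k, hk⟩

/-- `mem_cube_iff` (docstring added by the landing lane; see the module docstring). [formal bookkeeping] -/
theorem mem_cube_iff (M : ℕ) (x : Fin 3 → ℤ) : x ∈ cube M ↔ cmax x ≤ M := by
  rw [cube, Fintype.mem_piFinset]
  constructor
  · intro h
    apply Finset.sup_le
    intro k _
    have := h k
    rw [Finset.mem_Icc] at this
    omega
  · intro h k
    have := le_trans (natAbs_le_cmax x k) h
    rw [Finset.mem_Icc]; omega

/-- `cube_mono` (docstring added by the landing lane; see the module docstring). [formal bookkeeping] -/
theorem cube_mono {M N : ℕ} (h : M ≤ N) : cube M ⊆ cube N := fun x hx => by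
  rw [mem_cube_iff] at hx ⊢; exact hx.trans h

/-- `card_cube` (docstring added by the landing lane; see the module docstring). [formal bookkeeping] -/
theorem card_cube (M : ℕ) : (cube M).card = (2 * M + 1) ^ 3 := by
  rw [cube, Fintype.card_piFinset, Finset.prod_const, Finset.card_univ, Fintype.card_fin, Int.card_Icc]
  congr 1; omega

/-- `sq_cmax_le_nsq` (docstring added by the landing lane; see the module docstring). [formal bookkeeping] -/
theorem sq_cmax_le_nsq (x : Fin 3 → ℤ) : ((cmax x : ℝ)) ^ 2 ≤ nsq x := by
  obtain ⟨k, hk⟩ := exists_eq_cmax x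
  rw [hk]
  have : (((x k).natAbs : ℕ) : ℝ) ^ 2 = ((x k : ℝ)) ^ 2 := by
    rw [Nat.cast_natAbs, Int.cast_abs, sq_abs]
  rw [this]; exact sq_le_nsq x k

/-- Outside the cube `[−M, M]³` a lattice sum with `|n|⁻⁶` decay is small: the per-point bound. -/
theorem inv_nsq_cube_le {x : Fin 3 → ℤ} {m : ℕ} (hm : 1 ≤ m) (hx : m ≤ cmax x) :
    ((nsq x)⁻¹) ^ 3 ≤ (((m : ℝ)) ^ 2)⁻¹ ^ 3 := by
  have hm2 : (0 : ℝ) < ((m : ℝ)) ^ 2 := by positivity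
  have h1 : ((m : ℝ)) ^ 2 ≤ nsq x :=
    le_trans (pow_le_pow_left₀ (by positivity) (by exact_mod_cast hx) 2) (sq_cmax_le_nsq x)
  exact pow_le_pow_left₀ (inv_nonneg.2 (nsq_nonneg x)) (inv_anti₀ hm2 h1) 3

/-- `card_layer` (docstring added by the landing lane; see the module docstring). [formal bookkeeping] -/
theorem card_layer (M : ℕ) : (((cube (M + 1) \ cube M).card : ℕ) : ℝ) = 24 * ((M : ℝ) + 1) ^ 2 + 2 := by
  rw [Finset.card_sdiff_of_subset (cube_mono (Nat.le_succ M)), card_cube, card_cube]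
  have hle : (2 * M + 1) ^ 3 ≤ (2 * (M + 1) + 1) ^ 3 := Nat.pow_le_pow_left (by omega) 3
  push_cast [Nat.cast_sub hle]
  ring

/-- `sum_layer_le` (docstring added by the landing lane; see the module docstring). [formal bookkeeping] -/
theorem sum_layer_le {c : ℝ} (hc : 0 ≤ c) (M : ℕ) :
    ∑ x ∈ cube (M + 1) \ cube M, c * ((nsq x)⁻¹) ^ 3 ≤ (24 * ((M : ℝ) + 1) ^ 2 + 2) * (c * ((((M : ℝ) + 1) ^ 2)⁻¹ ^ 3)) := by
  have h := Finset.sum_le_card_nsmul (cube (M + 1) \ cube M) (fun x => c * ((nsq x)⁻¹) ^ 3)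
    (c * ((((M : ℝ) + 1) ^ 2)⁻¹ ^ 3)) fun x hx => by
      rw [Finset.mem_sdiff, mem_cube_iff, mem_cube_iff] at hx
      have hx' : M + 1 ≤ cmax x := by omega
      have := inv_nsq_cube_le (x := x) (m := M + 1) (by omega) hx'
      push_cast at this
      exact mul_le_mul_of_nonneg_left this hc
  rw [nsmul_eq_mul, card_layer] at h
  exact h

/-- `layer_step` (docstring added by the landing lane; see the module docstring). [formal bookkeeping] -/
theorem layer_step {c : ℝ} (hc : 0 ≤ c) {M : ℕ} (hM : 1 ≤ M) :
    (24 * ((M : ℝ) + 1) ^ 2 + 2) * (c * ((((M : ℝ) + 1) ^ 2)⁻¹ ^ 3)) ≤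
      26 * c * (1 / (3 * (M : ℝ) ^ 3) - 1 / (3 * ((M : ℝ) + 1) ^ 3)) := by
  have hM' : (1 : ℝ) ≤ M := by exact_mod_cast hM
  have hm0 : (0 : ℝ) < M := by linarith
  have key : 26 * c * (1 / (3 * (M : ℝ) ^ 3) - 1 / (3 * ((M : ℝ) + 1) ^ 3)) -
      (24 * ((M : ℝ) + 1) ^ 2 + 2) * (c * ((((M : ℝ) + 1) ^ 2)⁻¹ ^ 3)) =
      c * ((26 * (6 * (M : ℝ) ^ 2 + 4 * M + 1) * ((M : ℝ) + 1) ^ 2 + 3 * (2 * (((M : ℝ) + 1) ^ 2 - 1)) * (M : ℝ) ^ 3)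
        / (3 * (M : ℝ) ^ 3 * ((M : ℝ) + 1) ^ 6)) := by
    field_simp
    ring
  have hnum : 0 ≤ (26 * (6 * (M : ℝ) ^ 2 + 4 * M + 1) * ((M : ℝ) + 1) ^ 2 + 3 * (2 * (((M : ℝ) + 1) ^ 2 - 1)) * (M : ℝ) ^ 3) := by
    have : 0 ≤ ((M : ℝ) + 1) ^ 2 - 1 := by nlinarith
    positivity
  have : 0 ≤ c * ((26 * (6 * (M : ℝ) ^ 2 + 4 * M + 1) * ((M : ℝ) + 1) ^ 2 + 3 * (2 * (((M : ℝ) + 1) ^ 2 - 1)) * (M : ℝ) ^ 3)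
        / (3 * (M : ℝ) ^ 3 * ((M : ℝ) + 1) ^ 6)) := by positivity
  linarith

/-- `cube_sdiff_succ` (docstring added by the landing lane; see the module docstring). [formal bookkeeping] -/
theorem cube_sdiff_succ {K M : ℕ} (hKM : K ≤ M) :
    cube (M + 1) \ cube K = (cube M \ cube K) ∪ (cube (M + 1) \ cube M) := by
  ext x
  simp only [Finset.mem_sdiff, Finset.mem_union, mem_cube_iff]
  omega

/-- `disjoint_layers` (docstring added by the landing lane; see the module docstring). [formal bookkeeping] -/
theorem disjoint_layers (K M : ℕ) : Disjoint (cube M \ cube K) (cube (M + 1) \ cube M) :=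
  Finset.disjoint_left.2 fun x h1 h2 => by
    rw [Finset.mem_sdiff] at h1 h2
    exact h2.2 h1.1

/-- ★ The layer-cake bound: `Σ_{x ∈ [−M,M]³ ∖ [−K,K]³} c|x|⁻⁶ ≤ 26c(1/(3K³) − 1/(3M³))`. -/
theorem sum_sdiff_cube_le {c : ℝ} (hc : 0 ≤ c) {K : ℕ} (hK : 1 ≤ K) {M : ℕ} (hKM : K ≤ M) :
    ∑ x ∈ cube M \ cube K, c * ((nsq x)⁻¹) ^ 3 ≤ 26 * c * (1 / (3 * (K : ℝ) ^ 3) - 1 / (3 * (M : ℝ) ^ 3)) := by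
  induction M, hKM using Nat.le_induction with
  | base => simp
  | succ M hKM ih =>
    rw [cube_sdiff_succ hKM, Finset.sum_union (disjoint_layers K M)]
    have h1 := sum_layer_le hc M
    have h2 := layer_step hc (le_trans hK hKM)
    push_cast
    linarith

/-- `sum_sdiff_cube_le'` (docstring added by the landing lane; see the module docstring). [formal bookkeeping] -/
theorem sum_sdiff_cube_le' {c : ℝ} (hc : 0 ≤ c) {K : ℕ} (hK : 1 ≤ K) {M : ℕ} (hKM : K ≤ M) :
    ∑ x ∈ cube M \ cube K, c * ((nsq x)⁻¹) ^ 3 ≤ 26 * c / (3 * (K : ℝ) ^ 3) := by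
  refine (sum_sdiff_cube_le hc hK hKM).trans ?_
  have : 0 ≤ 26 * c * (1 / (3 * (M : ℝ) ^ 3)) := by positivity
  have h' : 26 * c * (1 / (3 * (K : ℝ) ^ 3)) = 26 * c / (3 * (K : ℝ) ^ 3) := by ring
  linarith

/-- The finite part of `D₃ ∖ 0` inside the cube `[−K, K]³`. -/
def cubeD (K : ℕ) : Finset D3 := (cube K).subtype fun n => n ≠ 0 ∧ Even (∑ k, n k)

/-- `mem_cubeD` (docstring added by the landing lane; see the module docstring). [formal bookkeeping] -/
theorem mem_cubeD {K : ℕ} {n : D3} : n ∈ cubeD K ↔ n.1 ∈ cube K := Finset.mem_subtype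

/-- The coordinate bound of a finite set of lattice vectors. -/
def cbound (s : Finset D3) : ℕ := s.sup fun n => cmax n.1

/-- `cmax_le_cbound` (docstring added by the landing lane; see the module docstring). [formal bookkeeping] -/
theorem cmax_le_cbound {s : Finset D3} {n : D3} (hn : n ∈ s) : cmax n.1 ≤ cbound s :=
  Finset.le_sup (f := fun n : D3 => cmax n.1) hn

/-- ★★ THE TAIL ESTIMATE.  If `f` is summable over `D₃ ∖ 0` and `|f(n)| ≤ c|n|⁻⁶` outside the cube `[−K, K]³` (`K ≥ 1`), then
`|Σ' f − Σ_{cube} f| ≤ 26c/(3K³)` (layer-cake: the shell `|n|_∞ = k` has `24k² + 2 ≤ 26k²` points and `Σ_{k>K} k⁻⁴ ≤ 1/(3K³)`). -/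
theorem abs_tsum_sub_sum_cubeD_le {f : D3 → ℝ} (hf : Summable f) {K : ℕ} (hK : 1 ≤ K) {c : ℝ} (hc : 0 ≤ c)
    (hfc : ∀ n : D3, n.1 ∉ cube K → |f n| ≤ c * ((nsq n.1)⁻¹) ^ 3) :
    |∑' n, f n - ∑ n ∈ cubeD K, f n| ≤ 26 * c / (3 * (K : ℝ) ^ 3) := by
  let g : D3 → ℝ := fun n => if n.1 ∈ cube K then 0 else f n
  have hgdef : ∀ n, g n = if n.1 ∈ cube K then 0 else f n := fun n => rfl
  have hgabs : ∀ n, ‖g n‖ ≤ |f n| := fun n => by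
    rw [Real.norm_eq_abs, hgdef n]; split_ifs <;> simp [abs_nonneg]
  have hgs : Summable g := Summable.of_norm_bounded hf.abs hgabs
  -- the finite part
  have hfg : ∑' n, (f n - g n) = ∑ n ∈ cubeD K, f n := by
    rw [tsum_eq_sum (s := cubeD K) (fun n hn => ?_)]
    · refine Finset.sum_congr rfl fun n hn => ?_
      rw [mem_cubeD] at hn
      rw [hgdef n, if_pos hn]; ring
    · rw [mem_cubeD] at hn
      rw [hgdef n, if_neg hn]; ring
  have hsplit : ∑' n, f n - ∑ n ∈ cubeD K, f n = ∑' n, g n := by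
    rw [← hfg, ← hf.tsum_sub (hf.sub hgs)]
    exact tsum_congr fun n => by ring
  rw [hsplit]
  -- partial sums of |g|
  have hpart : ∀ u : Finset D3, ∑ n ∈ u, |g n| ≤ 26 * c / (3 * (K : ℝ) ^ 3) := by
    intro u
    set M := max (cbound u) K with hM
    have hKM : K ≤ M := le_max_right _ _
    let φ : (Fin 3 → ℤ) → ℝ := fun x => if x ∈ cube K then 0 else c * ((nsq x)⁻¹) ^ 3
    have hφ0 : ∀ x, 0 ≤ φ x := fun x => by
      dsimp only [φ]; split_ifs
      · exact le_rfl
      · exact mul_nonneg hc (pow_nonneg (inv_nonneg.2 (nsq_nonneg x)) _)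
    have h1 : ∑ n ∈ u, |g n| ≤ ∑ n ∈ u, φ n.1 := Finset.sum_le_sum fun n _ => by
      rw [hgdef n]
      dsimp only [φ]
      split_ifs with h
      · simp
      · exact hfc n h
    have hsub : u.map ⟨Subtype.val, Subtype.val_injective⟩ ⊆ cube M := by
      intro x hx
      rw [Finset.mem_map] at hx
      obtain ⟨n, hn, rfl⟩ := hx
      rw [mem_cube_iff]
      exact (cmax_le_cbound hn).trans (le_max_left _ _)
    have h2 : ∑ n ∈ u, φ n.1 = ∑ x ∈ u.map ⟨Subtype.val, Subtype.val_injective⟩, φ x := by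
      rw [Finset.sum_map]; rfl
    have h3 : ∑ x ∈ u.map ⟨Subtype.val, Subtype.val_injective⟩, φ x ≤ ∑ x ∈ cube M, φ x :=
      Finset.sum_le_sum_of_subset_of_nonneg hsub fun x _ _ => hφ0 x
    have h4 : ∑ x ∈ cube M, φ x = ∑ x ∈ cube M \ cube K, c * ((nsq x)⁻¹) ^ 3 := by
      rw [← Finset.sum_sdiff (cube_mono hKM)]
      have hz : ∑ x ∈ cube K, φ x = 0 := Finset.sum_eq_zero fun x hx => by simp [φ, hx]
      rw [hz, add_zero]
      exact Finset.sum_congr rfl fun x hx => by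
        rw [Finset.mem_sdiff] at hx
        simp [φ, hx.2]
    calc ∑ n ∈ u, |g n| ≤ ∑ n ∈ u, φ n.1 := h1
      _ ≤ ∑ x ∈ cube M \ cube K, c * ((nsq x)⁻¹) ^ 3 := by rw [h2]; exact h3.trans h4.le
      _ ≤ 26 * c / (3 * (K : ℝ) ^ 3) := sum_sdiff_cube_le' hc hK hKM
  have htail : ∑' n, |g n| ≤ 26 * c / (3 * (K : ℝ) ^ 3) := Real.tsum_le_of_sum_le (fun n => abs_nonneg _) hpart
  have hn := norm_tsum_le_tsum_norm (f := g) (by simpa [Real.norm_eq_abs] using hgs.abs)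
  simp only [Real.norm_eq_abs] at hn
  exact hn.trans htail

end Numerics

end Fcc

end Summit.AtomisticToContinuum.Crystallization.Theorems.ChargedEnergyGapChartDial

end
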